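import Summits.CriticalPhenomena.PercolationContinuityZ3.Theorems.PercAnnulusCrossingHarrisSlackRenewal
import HarnessLib

/-!
# RSW3 lane (lead, gen 23): ANATOMY OF THE HARRIS SLACK, VIII — covariance against the geometric mean of the pivotal autocorrelations;
# a noise-sensitive event decouples from EVERY observable of bounded total influence; the critical cube crossing of `ℤ³`

builds on p205010 (kernel theorem, internal audit signed; external expert review pending) — USED in §2 (via part VI's pivotal renewal at
`p_c(ℤ³)`, which rests on gen 20's noise sensitivity and `θ(p_c) = 0`).

Cell `prim-rsw3` (LANE 3), lead seat, gen 23.  Support file (`--supports stmt-CriticalPhenomena-4575`); no definitions, no named facts,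
no sorries.  With `Φ_{f,g}(ε) = Σ_i p_i(1−p_i)E[D_i f(ω)D_i g(ω^ε)]` (part I: `Cov(f,g) = ∫_0^1 Φ_{f,g}`) and the pivotal autocorrelation `J_f = Φ_{f,f}`
(part V: `Var f = ∫_0^1 J_f`, `J_f ≥ 0` non-increasing, `J_f(0) = I(f) = Σ_i p_i(1−p_i)E[(D_i f)²]`), every `p ∈ [0,1]^ι`, ARBITRARY real `f, g`:

* §1 `abs_deriv_noise_le_sqrt_mul_sqrt` — `|Φ_{f,g}(ε)| ≤ √J_f(ε)·√J_g(ε)` (`ε ≤ 1`; Cauchy–Schwarz on `Σ_S |S|(1−ε)^{|S|−1}f̂(S)ĝ(S)`), a refinement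
  of `|Cov| ≤ σ_f σ_g` noise level by noise level; `intervalIntegrable_deriv_noise`;
  **`abs_cov_le_of_total_influence_le`** — if `I(g) ≤ K` then for every `δ ∈ (0,1]`:
  **`|E[fg] − E[f]E[g]| ≤ (√δ/2)·(Var f + K) + √K·√J_f(δ)`** (split `∫_0^1 Φ` at `δ`: before `δ`, AM–GM with parameter `√δ` and `∫_0^δ J_f ≤ Var f`;
  after `δ`, `J_f ≤ J_f(δ)` and `J_g ≤ J_g(0) = I(g) ≤ K`).  Since `J_f(δ) ≤ (2/δ)(E[f f^{δ/2}] − E[f]²)` (part VI), a NOISE-SENSITIVE sequence `f_n`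
  (`E[f_n f_n^a] − E[f_n]² → 0` for every `a > 0`, `Var f_n` bounded) satisfies `sup {|Cov(f_n, g)| : I(g) ≤ K} → 0` for every `K`:
  NOISE SENSITIVITY DECOUPLES AN EVENT FROM ALL OBSERVABLES OF BOUNDED TOTAL INFLUENCE (functions of boundedly many coordinates, linear
  statistics `Σ a_i(x_i − p_i)` with `Σ p_i(1−p_i)a_i² ≤ K`, and any nonlinear observable with `Σ_i p_i(1−p_i)E[(D_i g)²] ≤ K`).
* §2 **`cube_abs_cov_le_of_total_influence_le_criticalProbI`** — AT `p_c(ℤ³)`: for every `K ≥ 0` and `η > 0` there is `n₀` such that for all `n ≥ n₀`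
  and EVERY real function `g` of the pairs of `Λ(n)` with `Σ_e b_e(1−b_e)E_{p_c}[(D_e g)²] ≤ K`:
  **`|E_{p_c}[𝟙{cube {0..n}³ crossed}·g] − Π_{p_c}(n)·E_{p_c}[g]| ≤ η`** — THE CRITICAL CUBE CROSSING IS ASYMPTOTICALLY INDEPENDENT OF EVERY
  BOUNDED-INFLUENCE OBSERVABLE, uniformly (gen 21 had the linear statistics via revealment; here every observable, via parts I, V, VI).

References: I. Benjamini, G. Kalai, O. Schramm, Publ. IHÉS 90 (1999) Thm 1.5 and §1.4 (noise sensitivity vs correlation with majority-type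
functions); C. Garban, J. Steif, CUP 2014, Ch. IV–V; R. O'Donnell, CUP 2014, §2.3–2.4; M. Talagrand, Combinatorica 16 (1996) §2.
-/

noncomputable section

/-! ## §1 Covariance against the geometric mean of the pivotal autocorrelations -/

namespace Summit.CriticalPhenomena.PercolationContinuityZ3.Theorems.Crossing.Spectral

open Finset Function MeasureTheory intervalIntegral
open Literature.Probability.ODonnellSaksSchrammServedio2005

variable {ι : Type*} [Fintype ι] [DecidableEq ι] (p : ι → ℝ) (h0 : ∀ i, 0 ≤ p i) (h1 : ∀ i, p i ≤ 1)

include h0 h1 in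
/-- **`|Φ_{f,g}(ε)| ≤ √J_f(ε)·√J_g(ε)`** for `ε ≤ 1` and arbitrary real `f, g`: Cauchy–Schwarz on `Φ_{f,g}(ε) = Σ_S |S|(1−ε)^{|S|−1}f̂(S)ĝ(S)` (part I) against
`J_f(ε) = Σ_S |S|(1−ε)^{|S|−1}f̂(S)²` (part V). [cite: ODonnell2014, §2.4 (Stab_ρ and its derivative)] [cite: Talagrand1996, §2] -/
theorem abs_deriv_noise_le_sqrt_mul_sqrt (f g : (ι → Bool) → ℝ) {ε : ℝ} (hε : ε ≤ 1) :
    |∑ i, p i * (1 - p i) * ∑ x : ι → Bool, ∑ y : ι → Bool, ∑ m : ι → Bool, wt p x * wt p y * wt (fun _ => ε) m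
        * ((f (update x i true) - f (update x i false))
          * (g (update (fun j => if m j = true then y j else x j) i true)
            - g (update (fun j => if m j = true then y j else x j) i false)))|
      ≤ Real.sqrt (∑ i, p i * (1 - p i) * ∑ x : ι → Bool, ∑ y : ι → Bool, ∑ m : ι → Bool, wt p x * wt p y * wt (fun _ => ε) m
            * ((f (update x i true) - f (update x i false))
              * (f (update (fun j => if m j = true then y j else x j) i true)
                - f (update (fun j => if m j = true then y j else x j) i false))))
        * Real.sqrt (∑ i, p i * (1 - p i) * ∑ x : ι → Bool, ∑ y : ι → Bool, ∑ m : ι → Bool, wt p x * wt p y * wt (fun _ => ε) m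
            * ((g (update x i true) - g (update x i false))
              * (g (update (fun j => if m j = true then y j else x j) i true)
                - g (update (fun j => if m j = true then y j else x j) i false)))) := by
  classical
  have hH1 := pbiased_H1 p
  have hH2 := pbiased_H2 p h0 h1
  set r : ι → Bool → ℝ := fun j b => (((if b then (1 : ℝ) else 0) - p j) / Real.sqrt (p j * (1 - p j))) with hr
  obtain ⟨F, hF⟩ : ∃ F : Finset ι → ℝ, F = fun S => ∑ x : ι → Bool, wt p x * (f x * ∏ j ∈ S, r j (x j)) := ⟨_, rfl⟩
  obtain ⟨G, hG⟩ : ∃ G : Finset ι → ℝ, G = fun S => ∑ x : ι → Bool, wt p x * (g x * ∏ j ∈ S, r j (x j)) := ⟨_, rfl⟩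
  obtain ⟨c, hc⟩ : ∃ c : Finset ι → ℝ, c = fun S => (S.card : ℝ) * (1 - ε) ^ (S.card - 1) := ⟨_, rfl⟩
  have hc0 : ∀ S, 0 ≤ c S := fun S => by rw [hc]; exact mul_nonneg (Nat.cast_nonneg _) (pow_nonneg (by linarith) _)
  have hfg : ∑ i, p i * (1 - p i) * ∑ x : ι → Bool, ∑ y : ι → Bool, ∑ m : ι → Bool, wt p x * wt p y * wt (fun _ => ε) m
        * ((f (update x i true) - f (update x i false))
          * (g (update (fun j => if m j = true then y j else x j) i true)
            - g (update (fun j => if m j = true then y j else x j) i false)))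
      = ∑ S ∈ (Finset.univ : Finset ι).powerset, c S * (F S * G S) := by
    rw [sum_bias_mul_deriv_noise_eq hH1 hH2 f g ε, hF, hG, hc]
    exact Finset.sum_congr rfl fun S _ => by ring
  have hff : ∑ i, p i * (1 - p i) * ∑ x : ι → Bool, ∑ y : ι → Bool, ∑ m : ι → Bool, wt p x * wt p y * wt (fun _ => ε) m
        * ((f (update x i true) - f (update x i false))
          * (f (update (fun j => if m j = true then y j else x j) i true)
            - f (update (fun j => if m j = true then y j else x j) i false)))
      = ∑ S ∈ (Finset.univ : Finset ι).powerset, (Real.sqrt (c S) * |F S|) ^ 2 := by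
    rw [sum_bias_mul_deriv_noise_eq hH1 hH2 f f ε]
    refine Finset.sum_congr rfl fun S _ => ?_
    rw [mul_pow, Real.sq_sqrt (hc0 S), sq_abs]
    simp only [hc, hF]
    ring
  have hgg : ∑ i, p i * (1 - p i) * ∑ x : ι → Bool, ∑ y : ι → Bool, ∑ m : ι → Bool, wt p x * wt p y * wt (fun _ => ε) m
        * ((g (update x i true) - g (update x i false))
          * (g (update (fun j => if m j = true then y j else x j) i true)
            - g (update (fun j => if m j = true then y j else x j) i false)))
      = ∑ S ∈ (Finset.univ : Finset ι).powerset, (Real.sqrt (c S) * |G S|) ^ 2 := by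
    rw [sum_bias_mul_deriv_noise_eq hH1 hH2 g g ε]
    refine Finset.sum_congr rfl fun S _ => ?_
    rw [mul_pow, Real.sq_sqrt (hc0 S), sq_abs]
    simp only [hc, hG]
    ring
  rw [hfg, hff, hgg]
  have hcs := Real.sum_mul_le_sqrt_mul_sqrt (Finset.univ : Finset ι).powerset
    (fun S => Real.sqrt (c S) * |F S|) (fun S => Real.sqrt (c S) * |G S|)
  refine le_trans ?_ hcs
  refine (Finset.abs_sum_le_sum_abs _ _).trans (le_of_eq (Finset.sum_congr rfl fun S _ => ?_))
  rw [abs_mul, abs_mul, abs_of_nonneg (hc0 S)]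
  have := Real.mul_self_sqrt (hc0 S)
  calc c S * (|F S| * |G S|) = (Real.sqrt (c S) * Real.sqrt (c S)) * (|F S| * |G S|) := by rw [this]
    _ = Real.sqrt (c S) * |F S| * (Real.sqrt (c S) * |G S|) := by ring

include h0 h1 in
/-- The mixed integrand `Φ_{f,g}` is a polynomial in the noise level, hence interval-integrable. [folklore] -/
theorem intervalIntegrable_deriv_noise (f g : (ι → Bool) → ℝ) (a b : ℝ) :
    IntervalIntegrable (fun ε : ℝ => ∑ i, p i * (1 - p i) * ∑ x : ι → Bool, ∑ y : ι → Bool, ∑ m : ι → Bool,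
        wt p x * wt p y * wt (fun _ => ε) m
          * ((f (update x i true) - f (update x i false))
            * (g (update (fun j => if m j = true then y j else x j) i true)
              - g (update (fun j => if m j = true then y j else x j) i false)))) volume a b := by
  have hpoly : ∀ ε : ℝ, (∑ i, p i * (1 - p i) * ∑ x : ι → Bool, ∑ y : ι → Bool, ∑ m : ι → Bool, wt p x * wt p y * wt (fun _ => ε) m
        * ((f (update x i true) - f (update x i false))
          * (g (update (fun j => if m j = true then y j else x j) i true)
            - g (update (fun j => if m j = true then y j else x j) i false))))
      = ∑ S ∈ (Finset.univ : Finset ι).powerset, (S.card : ℝ) * ((1 - ε) ^ (S.card - 1)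
          * ((∑ x : ι → Bool, wt p x * (f x * ∏ j ∈ S, (((if x j then (1 : ℝ) else 0) - p j) / Real.sqrt (p j * (1 - p j)))))
            * (∑ x : ι → Bool, wt p x * (g x * ∏ j ∈ S, (((if x j then (1 : ℝ) else 0) - p j) / Real.sqrt (p j * (1 - p j))))))) :=
    fun ε => sum_bias_mul_deriv_noise_eq (pbiased_H1 p) (pbiased_H2 p h0 h1) f g ε
  rw [show (fun ε : ℝ => ∑ i, p i * (1 - p i) * ∑ x : ι → Bool, ∑ y : ι → Bool, ∑ m : ι → Bool, wt p x * wt p y * wt (fun _ => ε) m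
        * ((f (update x i true) - f (update x i false))
          * (g (update (fun j => if m j = true then y j else x j) i true)
            - g (update (fun j => if m j = true then y j else x j) i false))))
      = fun ε => ∑ S ∈ (Finset.univ : Finset ι).powerset, (S.card : ℝ) * ((1 - ε) ^ (S.card - 1)
          * ((∑ x : ι → Bool, wt p x * (f x * ∏ j ∈ S, (((if x j then (1 : ℝ) else 0) - p j) / Real.sqrt (p j * (1 - p j)))))
            * (∑ x : ι → Bool, wt p x * (g x * ∏ j ∈ S, (((if x j then (1 : ℝ) else 0) - p j) / Real.sqrt (p j * (1 - p j)))))))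
      from funext hpoly]
  exact (continuous_finsetSum _ fun S _ => by fun_prop).intervalIntegrable a b

include h0 h1 in
/-- **A BOUNDED-INFLUENCE OBSERVABLE SEES ONLY THE NOISE-STABLE PART**: for arbitrary real `f, g` on the p-biased cube (every `p ∈ [0,1]^ι`),
if the total influence of `g` is at most `K` (`Σ_i p_i(1−p_i)E[(D_i g)²] ≤ K`) then for every `δ ∈ (0,1]`
**`|E[fg] − E[f]E[g]| ≤ (√δ/2)·(Var f + K) + √K·√J_f(δ)`**, `J_f(δ) = Σ_i p_i(1−p_i)E[D_i f(ω)D_i f(ω^δ)]` the pivotal autocorrelation of `f` at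
noise `δ` (≤ `(2/δ)(E[f f^{δ/2}] − E[f]²)`, part VI).  Hence a noise-sensitive sequence decouples from all observables of bounded total influence,
uniformly. [cite: BenjaminiKalaiSchramm1999, Thm 1.5 (noise sensitivity and correlation with majority functions)] [cite: ODonnell2014, §2.3–2.4] -/
theorem abs_cov_le_of_total_influence_le (f g : (ι → Bool) → ℝ) {K : ℝ}
    (hK : ∑ i, p i * (1 - p i) * ∑ x : ι → Bool, wt p x * (g (update x i true) - g (update x i false)) ^ 2 ≤ K)
    {δ : ℝ} (hδ0 : 0 < δ) (hδ1 : δ ≤ 1) :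
    |∑ x : ι → Bool, wt p x * (f x * g x) - (∑ x : ι → Bool, wt p x * f x) * (∑ x : ι → Bool, wt p x * g x)|
      ≤ Real.sqrt δ / 2 * ((∑ x : ι → Bool, wt p x * (f x * f x) - (∑ x : ι → Bool, wt p x * f x) ^ 2) + K)
        + Real.sqrt K * Real.sqrt (∑ i, p i * (1 - p i) * ∑ x : ι → Bool, ∑ y : ι → Bool, ∑ m : ι → Bool,
            wt p x * wt p y * wt (fun _ => δ) m
              * ((f (update x i true) - f (update x i false))
                * (f (update (fun j => if m j = true then y j else x j) i true)
                  - f (update (fun j => if m j = true then y j else x j) i false)))) := by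
  -- names for the three noise functionals
  obtain ⟨Φ, hΦ⟩ : ∃ Φ : ℝ → ℝ, Φ = fun ε => ∑ i, p i * (1 - p i) * ∑ x : ι → Bool, ∑ y : ι → Bool, ∑ m : ι → Bool,
      wt p x * wt p y * wt (fun _ => ε) m
        * ((f (update x i true) - f (update x i false))
          * (g (update (fun j => if m j = true then y j else x j) i true)
            - g (update (fun j => if m j = true then y j else x j) i false))) := ⟨_, rfl⟩
  obtain ⟨Jf, hJf⟩ : ∃ Jf : ℝ → ℝ, Jf = fun ε => ∑ i, p i * (1 - p i) * ∑ x : ι → Bool, ∑ y : ι → Bool, ∑ m : ι → Bool,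
      wt p x * wt p y * wt (fun _ => ε) m
        * ((f (update x i true) - f (update x i false))
          * (f (update (fun j => if m j = true then y j else x j) i true)
            - f (update (fun j => if m j = true then y j else x j) i false))) := ⟨_, rfl⟩
  obtain ⟨Jg, hJg⟩ : ∃ Jg : ℝ → ℝ, Jg = fun ε => ∑ i, p i * (1 - p i) * ∑ x : ι → Bool, ∑ y : ι → Bool, ∑ m : ι → Bool,
      wt p x * wt p y * wt (fun _ => ε) m
        * ((g (update x i true) - g (update x i false))
          * (g (update (fun j => if m j = true then y j else x j) i true)
            - g (update (fun j => if m j = true then y j else x j) i false))) := ⟨_, rfl⟩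
  have hK0 : 0 ≤ K := le_trans (Finset.sum_nonneg fun i _ => mul_nonneg (mul_nonneg (h0 i) (by linarith [h1 i]))
    (Finset.sum_nonneg fun x _ => mul_nonneg (wt_nonneg h0 h1 x) (sq_nonneg _))) hK
  -- pointwise facts
  have hpt : ∀ ε, ε ≤ 1 → |Φ ε| ≤ Real.sqrt (Jf ε) * Real.sqrt (Jg ε) := by
    intro ε hε; rw [hΦ, hJf, hJg]; exact abs_deriv_noise_le_sqrt_mul_sqrt p h0 h1 f g hε
  have hJf0 : ∀ ε, ε ≤ 1 → 0 ≤ Jf ε := by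
    intro ε hε; rw [hJf]; exact pivotal_autocorrelation_nonneg p h0 h1 f hε
  have hJg0 : ∀ ε, ε ≤ 1 → 0 ≤ Jg ε := by
    intro ε hε; rw [hJg]; exact pivotal_autocorrelation_nonneg p h0 h1 g hε
  have hJf_anti : ∀ a b, a ≤ b → b ≤ 1 → Jf b ≤ Jf a := by
    intro a b hab hb; rw [hJf]; exact pivotal_autocorrelation_antitone p h0 h1 f hab hb
  have hJg_le : ∀ ε, 0 ≤ ε → ε ≤ 1 → Jg ε ≤ K := by
    intro ε hε0 hε1
    have h := pivotal_autocorrelation_antitone p h0 h1 g hε0 hε1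
    rw [pivotal_autocorrelation_zero p g] at h
    rw [hJg]; exact h.trans hK
  -- the covariance and the variance as integrals
  have hcov : ∑ x : ι → Bool, wt p x * (f x * g x) - (∑ x : ι → Bool, wt p x * f x) * (∑ x : ι → Bool, wt p x * g x)
      = ∫ ε in (0 : ℝ)..1, Φ ε := by rw [hΦ]; exact cov_eq_integral p h0 h1 f g
  have hvar : ∑ x : ι → Bool, wt p x * (f x * f x) - (∑ x : ι → Bool, wt p x * f x) ^ 2 = ∫ ε in (0 : ℝ)..1, Jf ε := by
    rw [hJf]; exact var_eq_integral_pivotal_autocorrelation p h0 h1 f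
  have hIΦ : ∀ a b, IntervalIntegrable Φ volume a b := by
    intro a b; rw [hΦ]; exact intervalIntegrable_deriv_noise p h0 h1 f g a b
  have hIJ : ∀ a b, IntervalIntegrable Jf volume a b := by
    intro a b; rw [hJf]; exact intervalIntegrable_pivotal_autocorrelation p h0 h1 f a b
  -- split at `δ`
  rw [hcov, ← intervalIntegral.integral_add_adjacent_intervals (hIΦ 0 δ) (hIΦ δ 1)]
  refine (abs_add_le _ _).trans (add_le_add ?_ ?_)
  · -- before `δ`: AM–GM with parameter `√δ`, then `∫_0^δ J_f ≤ Var f`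
    have hs : 0 < Real.sqrt δ := Real.sqrt_pos.2 hδ0
    have hbd : ∀ ε ∈ Set.Icc (0 : ℝ) δ, |Φ ε| ≤ Real.sqrt δ / 2 * Jf ε + K / (2 * Real.sqrt δ) := by
      intro ε hε
      have hε1 : ε ≤ 1 := hε.2.trans hδ1
      refine (hpt ε hε1).trans ?_
      have hg' : Real.sqrt (Jg ε) ≤ Real.sqrt K := Real.sqrt_le_sqrt (hJg_le ε hε.1 hε1)
      refine (mul_le_mul_of_nonneg_left hg' (Real.sqrt_nonneg _)).trans ?_
      -- AM–GM with the parameter `√δ`: `√a·√b ≤ (s·a + b/s)/2`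
      have hamgm : Real.sqrt (Jf ε) * Real.sqrt K ≤ (Real.sqrt δ * Jf ε + K / Real.sqrt δ) / 2 := by
        have h2 := two_mul_le_add_sq (Real.sqrt (Real.sqrt δ) * Real.sqrt (Jf ε)) (Real.sqrt K / Real.sqrt (Real.sqrt δ))
        have hs' : 0 < Real.sqrt (Real.sqrt δ) := Real.sqrt_pos.2 hs
        have e1 : (Real.sqrt (Real.sqrt δ) * Real.sqrt (Jf ε)) * (Real.sqrt K / Real.sqrt (Real.sqrt δ))
            = Real.sqrt (Jf ε) * Real.sqrt K := by
          field_simp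
        have e2 : (Real.sqrt (Real.sqrt δ) * Real.sqrt (Jf ε)) ^ 2 = Real.sqrt δ * Jf ε := by
          rw [mul_pow, Real.sq_sqrt hs.le, Real.sq_sqrt (hJf0 ε hε1)]
        have e3 : (Real.sqrt K / Real.sqrt (Real.sqrt δ)) ^ 2 = K / Real.sqrt δ := by
          rw [div_pow, Real.sq_sqrt hK0, Real.sq_sqrt hs.le]
        rw [mul_assoc, e1, e2, e3] at h2
        linarith
      refine hamgm.trans (le_of_eq ?_)
      field_simp
    have h1' : |∫ ε in (0 : ℝ)..δ, Φ ε| ≤ ∫ ε in (0 : ℝ)..δ, (Real.sqrt δ / 2 * Jf ε + K / (2 * Real.sqrt δ)) := by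
      refine (intervalIntegral.abs_integral_le_integral_abs hδ0.le).trans ?_
      exact intervalIntegral.integral_mono_on hδ0.le ((hIΦ 0 δ).abs) (((hIJ 0 δ).const_mul _).add intervalIntegrable_const) hbd
    rw [intervalIntegral.integral_add ((hIJ 0 δ).const_mul _) intervalIntegrable_const, intervalIntegral.integral_const_mul,
      intervalIntegral.integral_const, smul_eq_mul, sub_zero] at h1'
    -- `∫_0^δ J_f ≤ ∫_0^1 J_f = Var f`
    have hJint : ∫ ε in (0 : ℝ)..δ, Jf ε ≤ ∫ ε in (0 : ℝ)..1, Jf ε := by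
      rw [← intervalIntegral.integral_add_adjacent_intervals (hIJ 0 δ) (hIJ δ 1)]
      have : 0 ≤ ∫ ε in δ..1, Jf ε := intervalIntegral.integral_nonneg hδ1 fun ε hε => hJf0 ε hε.2
      linarith
    rw [← hvar] at hJint
    have hsq : δ * (K / (2 * Real.sqrt δ)) = Real.sqrt δ / 2 * K := by
      have hd : δ = Real.sqrt δ * Real.sqrt δ := (Real.mul_self_sqrt hδ0.le).symm
      field_simp
      nlinarith [hd]
    have hJint' : Real.sqrt δ / 2 * (∫ ε in (0 : ℝ)..δ, Jf ε)
        ≤ Real.sqrt δ / 2 * (∑ x : ι → Bool, wt p x * (f x * f x) - (∑ x : ι → Bool, wt p x * f x) ^ 2) :=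
      mul_le_mul_of_nonneg_left hJint (by positivity)
    calc |∫ ε in (0 : ℝ)..δ, Φ ε| ≤ Real.sqrt δ / 2 * (∫ ε in (0 : ℝ)..δ, Jf ε) + δ * (K / (2 * Real.sqrt δ)) := h1'
      _ ≤ Real.sqrt δ / 2 * (∑ x : ι → Bool, wt p x * (f x * f x) - (∑ x : ι → Bool, wt p x * f x) ^ 2) + Real.sqrt δ / 2 * K := by
          rw [hsq]; linarith [hJint']
      _ = _ := by ring
  · -- after `δ`: `J_f ≤ J_f(δ)`, `J_g ≤ K`
    have hbd : ∀ ε ∈ Set.Icc δ 1, |Φ ε| ≤ Real.sqrt K * Real.sqrt (Jf δ) := by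
      intro ε hε
      refine (hpt ε hε.2).trans ?_
      rw [mul_comm]
      exact mul_le_mul (Real.sqrt_le_sqrt (hJg_le ε (hδ0.le.trans hε.1) hε.2)) (Real.sqrt_le_sqrt (hJf_anti δ ε hε.1 hε.2))
        (Real.sqrt_nonneg _) (Real.sqrt_nonneg _)
    have h2' : |∫ ε in δ..1, Φ ε| ≤ ∫ ε in δ..1, Real.sqrt K * Real.sqrt (Jf δ) := by
      refine (intervalIntegral.abs_integral_le_integral_abs hδ1).trans ?_
      exact intervalIntegral.integral_mono_on hδ1 ((hIΦ δ 1).abs) intervalIntegrable_const hbd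
    rw [intervalIntegral.integral_const, smul_eq_mul] at h2'
    refine h2'.trans ?_
    rw [hJf]
    have hnn : 0 ≤ Real.sqrt K * Real.sqrt (Jf δ) := mul_nonneg (Real.sqrt_nonneg _) (Real.sqrt_nonneg _)
    rw [hJf] at hnn
    nlinarith [hnn, hδ0, hδ1]

end Summit.CriticalPhenomena.PercolationContinuityZ3.Theorems.Crossing.Spectral

/-! ## §2 The critical cube crossing of `ℤ³` is asymptotically independent of every bounded-influence observable -/

namespace Summit.CriticalPhenomena.PercolationContinuityZ3.Theorems.Crossing

open MeasureTheory Finset Function Filter Topology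
open Literature.Probability.Percolation Literature.Probability.LatticeModels
open Literature.Probability.ODonnellSaksSchrammServedio2005
open Literature.Probability.Percolation.GhostExploration Literature.Probability.Percolation.SeedExploration
open Literature.Probability.Percolation.OneArmOSSS Literature.Probability.Percolation.DCT16
open Summit.CriticalPhenomena.PercolationContinuityZ3.Theorems.SurfaceTension
open Summit.CriticalPhenomena.PercolationContinuityZ3.Theorems.CrossingRevealment
open Summit.CriticalPhenomena.PercolationContinuityZ3.Theorems.Crossing.Spectral

/-- **THE CRITICAL CUBE CROSSING OF `ℤ³` IS ASYMPTOTICALLY INDEPENDENT OF EVERY BOUNDED-INFLUENCE OBSERVABLE, UNIFORMLY**: with `g_n` the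
indicator of the crossing of `{0..n}³` in direction `0` read on the cube of `Λ(n)` (`E_{p_c} g_n = Π_{p_c}(n)`) and `b = boxBias 3 n p_c`: for every
`K ≥ 0` and `η > 0` there is `n₀` such that for all `n ≥ n₀` and EVERY real `g` on the cube of `Λ(n)` with total influence
`Σ_e b_e(1−b_e)E_{p_c}[(D_e g)²] ≤ K`, **`|E_{p_c}[g_n·g] − Π_{p_c}(n)·E_{p_c}[g]| ≤ η`** (§1 with `Var g_n ≤ 1` and part VI's pivotal renewal
`J_{g_n}(δ) → 0`). [cite: BenjaminiKalaiSchramm1999, Thm 1.5 and §1.4] [cite: GarbanSteif2014, Ch. V] -/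
theorem cube_abs_cov_le_of_total_influence_le_criticalProbI {K : ℝ} (hK : 0 ≤ K) {η : ℝ} (hη : 0 < η) :
    ∃ n₀ : ℕ, ∀ n, n₀ ≤ n → ∀ g : (PairIdx 3 n → Bool) → ℝ,
      (∑ e : PairIdx 3 n, boxBias 3 n (criticalProbI 3) e * (1 - boxBias 3 n (criticalProbI 3) e)
          * ∑ x : PairIdx 3 n → Bool, wt (boxBias 3 n (criticalProbI 3)) x * (g (update x e true) - g (update x e false)) ^ 2 ≤ K) →
      |∑ x : PairIdx 3 n → Bool, wt (boxBias 3 n (criticalProbI 3)) x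
            * (gcross (fun a b : BoxV 3 n => if a.1 ∈ Icc 0 (cubeShape n) ∧ b.1 ∈ Icc 0 (cubeShape n) then latEdge 3 n a b else none)
                {v : BoxV 3 n | v.1 ∈ Icc 0 (cubeShape n) ∧ v.1 0 = 0} {v : BoxV 3 n | v.1 ∈ Icc 0 (cubeShape n) ∧ v.1 0 = cubeShape n 0} x
              * g x)
          - boxCrossProb 3 (criticalProbI 3) (cubeShape n) 0 * ∑ x : PairIdx 3 n → Bool, wt (boxBias 3 n (criticalProbI 3)) x * g x| ≤ η := by
  classical
  -- choose `δ` with `(√δ/2)(1 + K) ≤ η/2`, then `n₀` with `√K √J_n(δ) ≤ η/2`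
  obtain ⟨δ, hδ0, hδ1, hδ⟩ : ∃ δ : ℝ, 0 < δ ∧ δ ≤ 1 ∧ Real.sqrt δ / 2 * (1 + K) ≤ η / 2 := by
    refine ⟨min 1 ((η / (1 + K)) ^ 2), lt_min one_pos (by positivity), min_le_left _ _, ?_⟩
    have hs : Real.sqrt (min 1 ((η / (1 + K)) ^ 2)) ≤ η / (1 + K) := by
      calc Real.sqrt (min 1 ((η / (1 + K)) ^ 2)) ≤ Real.sqrt ((η / (1 + K)) ^ 2) := Real.sqrt_le_sqrt (min_le_right _ _)
        _ = η / (1 + K) := Real.sqrt_sq (by positivity)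
    have h1K : 0 < 1 + K := by linarith
    calc Real.sqrt (min 1 ((η / (1 + K)) ^ 2)) / 2 * (1 + K) ≤ (η / (1 + K)) / 2 * (1 + K) :=
          mul_le_mul_of_nonneg_right (div_le_div_of_nonneg_right hs (by norm_num)) h1K.le
      _ = η / 2 := by field_simp
  have hJ := tendsto_cube_pivotal_autocorrelation_criticalProbI hδ0 hδ1
  have hε2 : 0 < (η / 2) ^ 2 / (K + 1) := by positivity
  obtain ⟨n₀, hn₀⟩ := (Metric.tendsto_atTop.1 hJ) ((η / 2) ^ 2 / (K + 1)) hε2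
  refine ⟨n₀, fun n hn g hg => ?_⟩
  set b := boxBias 3 n (criticalProbI 3) with hb
  set f : (PairIdx 3 n → Bool) → ℝ := gcross (fun a b : BoxV 3 n => if a.1 ∈ Icc 0 (cubeShape n) ∧ b.1 ∈ Icc 0 (cubeShape n)
      then latEdge 3 n a b else none)
    {v : BoxV 3 n | v.1 ∈ Icc 0 (cubeShape n) ∧ v.1 0 = 0} {v : BoxV 3 n | v.1 ∈ Icc 0 (cubeShape n) ∧ v.1 0 = cubeShape n 0} with hf
  have hb0 : ∀ e, 0 ≤ b e := boxBias_nonneg n (criticalProbI 3).2.1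
  have hb1 : ∀ e, b e ≤ 1 := boxBias_le_one n (criticalProbI 3).2.2
  have hmean : ∑ x : PairIdx 3 n → Bool, wt b x * f x = boxCrossProb 3 (criticalProbI 3) (cubeShape n) 0 :=
    sum_wt_gcross_hyperplanes_eq (cubeShape n) 0 n (Icc_cubeShape_subset_box n) (criticalProbI 3)
  have hmain := abs_cov_le_of_total_influence_le b hb0 hb1 f g hg hδ0 hδ1
  rw [hmean] at hmain
  refine hmain.trans ?_
  -- `Var f ≤ 1`
  have hf01 : ∀ x, f x * f x = f x := by intro x; rw [hf]; unfold gcross; split_ifs <;> norm_num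
  have hvar1 : ∑ x : PairIdx 3 n → Bool, wt b x * (f x * f x) - (boxCrossProb 3 (criticalProbI 3) (cubeShape n) 0) ^ 2 ≤ 1 := by
    simp only [hf01]
    rw [hmean]
    have hP1 : boxCrossProb 3 (criticalProbI 3) (cubeShape n) 0 ≤ 1 := by
      unfold boxCrossProb; exact measureReal_le_one
    nlinarith [sq_nonneg (boxCrossProb 3 (criticalProbI 3) (cubeShape n) 0)]
  -- `J_n(δ) < (η/2)²/(K+1)`
  have hJn := hn₀ n hn
  rw [Real.dist_eq, sub_zero] at hJn
  have hJn' := (le_abs_self _).trans_lt hJn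
  have hsqrt : Real.sqrt K * Real.sqrt (∑ e : PairIdx 3 n, b e * (1 - b e)
      * ∑ x : PairIdx 3 n → Bool, ∑ y : PairIdx 3 n → Bool, ∑ ν : PairIdx 3 n → Bool,
          wt b x * wt b y * wt (fun _ => δ) ν
          * ((f (update x e true) - f (update x e false))
            * (f (update (fun j => if ν j = true then y j else x j) e true)
              - f (update (fun j => if ν j = true then y j else x j) e false)))) ≤ η / 2 := by
    rw [← Real.sqrt_mul hK]
    refine (Real.sqrt_le_sqrt (mul_le_mul_of_nonneg_left hJn'.le hK)).trans ?_
    have hle : K * ((η / 2) ^ 2 / (K + 1)) ≤ (η / 2) ^ 2 := by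
      rw [mul_div_assoc']
      refine (div_le_iff₀ (by linarith)).2 ?_
      nlinarith [sq_nonneg (η / 2)]
    calc Real.sqrt (K * ((η / 2) ^ 2 / (K + 1))) ≤ Real.sqrt ((η / 2) ^ 2) := Real.sqrt_le_sqrt hle
      _ = η / 2 := Real.sqrt_sq (by positivity)
  have hfirst : Real.sqrt δ / 2 * ((∑ x : PairIdx 3 n → Bool, wt b x * (f x * f x)
      - (boxCrossProb 3 (criticalProbI 3) (cubeShape n) 0) ^ 2) + K) ≤ η / 2 :=
    le_trans (mul_le_mul_of_nonneg_left (by linarith [hvar1]) (by positivity)) hδ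
  linarith [hfirst, hsqrt]

end Summit.CriticalPhenomena.PercolationContinuityZ3.Theorems.Crossing

end
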